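import Summits.HodgeConjecture.HodgeConjecture.Theses.GenericDivisibility
import Literature.AlgebraicGeometry.HodgeTheory.IntegralClassesCountable

/-!
# Route GenericDivisibility — reductions for the crux `HodgeClassesGenericallyDivisible` (C1, item stmt-HodgeConjecture-18466)

The crux C1 of route `GenericDivisibility`: on a smooth projective complex `2p`-fold `X` (`p ≥ 1`),
an integral class `z ∈ H²ᵖ(X(ℂ); ℤ)` whose complexification is of Hodge type `(p, p)` is, for every
`m ≥ 1`, divisible by `m` on the complex points of some non-empty Zariski open `X ∖ Z`.

For `p ≥ 2` this is a statement of Hodge-conjecture strength (Colliot-Thélène–Voisin 2012, §3: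
granted the torsion-freeness of the Zariski sheaf `𝓗²ᵖ(ℤ)`, C1 says that the unramified class of
`z` is divisible, while the Hodge conjecture says it vanishes).  This file does NOT prove C1; it
records, sorry-free and on the route's own carriers, the reductions every line on C1 uses:

* `hodgeClassesGenericallyDivisible_of_divisibleModTorsion` — the glue of the planner's birth
  skeleton: if every such `z` is, on some non-empty Zariski open, congruent to an `m`-multiple
  modulo a class killed by some `N ≥ 1`, then the route's support item `TorsionDiesGenerically`
  (Colliot-Thélène–Voisin 2012, Thm. 3.1) gives C1 (shrink the open once more);
* `hodgeClassesGenericallyDivisible_of_genericallyTorsion` — in particular C1 holds (with `y = 0`)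
  as soon as every such `z` is torsion on some non-empty Zariski open;
* `hodgeClassesGenericallyDivisible_of_coniveau_one` — C1 holds as soon as the complexification of
  every such `z` has coniveau `≥ 1` (`supportedClasses X (2p) 1`), granted `TorsionDiesGenerically`
  and the universal-coefficient statement that an integral class on `(X ∖ Z)(ℂ)` with vanishing
  complexification is torsion (finite generation of the homology of smooth quasi-projective
  varieties; taken as an explicit hypothesis, not in the tree);
* `hodgeClassesGenericallyDivisible_of_hodgeConjecture` — hence the Hodge conjecture itself implies
  C1 under the same two provisos ("C1 is target-implied": `Nᵖ ⊆ N¹` for `p ≥ 1`).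

Only the thesis file and two proved Literature modules are imported; every extra input is an
explicit hypothesis, so nothing here is conditional on a hidden named fact.
-/

-- `Summit.HodgeConjecture.HodgeConjecture.Theorems` is the mandated namespace (single-problem summit:
-- Problem = Summit), which `linter.dupNamespace` flags on every declaration; the lakefile turns the
-- linter off tree-wide (weak option), restated here so stand-alone elaboration is warning-free too.
set_option linter.dupNamespace false

noncomputable section

namespace Summit.HodgeConjecture.HodgeConjecture.Theorems

open CategoryTheory AlgebraicGeometry
open Literature.AlgebraicGeometry.Motives Literature.AlgebraicGeometry.HodgeTheory
  Literature.AlgebraicTopology.SingularHomology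
open Summit.HodgeConjecture.HodgeConjecture.Theses.GenericDivisibility

universe u

/-! ### Functoriality bookkeeping on complements of Zariski-closed subsets -/

/-- Restricting from `X(ℂ)` to `(X ∖ Z)(ℂ)` and then to `(X ∖ Z')(ℂ)`, `Z ⊆ Z'`, is restricting to
`(X ∖ Z')(ℂ)` (contravariant functoriality of `Hⁿ`, Hatcher §3.1), for any coefficient ring; the
inclusion `(X ∖ Z')(ℂ) ↪ (X ∖ Z)(ℂ)` is spelled exactly as in the route decl
`TorsionDiesGenerically`. [cite: HatcherAT2002, §3.1] -/
theorem genericDivisibility_restrict_restrict (R : Type) [CommRing R] {X : SchemeOver ℂ}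
    {Z Z' : Set X.left} (h : Z ⊆ Z') (n : ℕ) (z : singularCohomology R R (ComplexPoints X) n) :
    singularCohomology.map R R
        (⟨fun P : complexPointsCompl X Z' => (⟨P.1, fun hP : P.1.pt ∈ Z => P.2 (h hP)⟩ :
            complexPointsCompl X Z),
          continuous_subtype_val.subtype_mk fun (P : complexPointsCompl X Z') (hP : P.1.pt ∈ Z) =>
            P.2 (h hP)⟩ : C(complexPointsCompl X Z', complexPointsCompl X Z)) n
        (singularCohomology.map R R
          (⟨Subtype.val, continuous_subtype_val⟩ : C(complexPointsCompl X Z, ComplexPoints X)) n z) =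
      singularCohomology.map R R
        (⟨Subtype.val, continuous_subtype_val⟩ : C(complexPointsCompl X Z', ComplexPoints X)) n z := by
  rw [← ModuleCat.comp_apply, ← singularCohomology.map_comp]
  rfl

/-- **Change of coefficients commutes with pull-back**: `(f^* x) ⊗ ℂ = f^* (x ⊗ ℂ)` for the
coefficient extension `ℤ → ℂ` (both sides are computed on a representing cocycle `u` as
`σ ↦ u (f ∘ σ)` read in `ℂ`; Hatcher §3.1 p. 198). [cite: HatcherAT2002, §3.1 p. 198] -/
theorem genericDivisibility_ringChange_map {S T : Type u} [TopologicalSpace S] [TopologicalSpace T]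
    (f : C(S, T)) (n : ℕ) (x : singularCohomology ℤ ℤ T n) :
    singularCohomology.ringChange (Int.castRingHom ℂ) S n (singularCohomology.map ℤ ℤ f n x) =
      singularCohomology.map ℂ ℂ f n (singularCohomology.ringChange (Int.castRingHom ℂ) T n x) := by
  induction x using singularCohomology_induction_on with
  | h u =>
    rw [singularCohomology.map_π, singularCohomology.ringChange_π, singularCohomology.ringChange_π,
      singularCohomology.map_π]
    congr 1
    refine coFn_injective ?_
    rw [coFn_cocyclesRingChange, coFn_cocyclesMap, coFn_cocyclesMap, coFn_cocyclesRingChange]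
    rfl

/-! ### The glue of the birth skeleton: divisible modulo torsion on an open ⇒ C1 -/

/-- **Birth-skeleton glue for C1.** Suppose that for every `p ≥ 1`, every smooth projective complex
`2p`-fold `X`, every integral class `z ∈ H²ᵖ(X(ℂ); ℤ)` with complexification of Hodge type `(p, p)`
and every `m ≥ 1` there are a Zariski-closed `Z ≠ X`, a class `y` on `(X ∖ Z)(ℂ)` and `N ≥ 1` with
`N • (z|_{(X∖Z)(ℂ)} - m • y) = 0` ("divisible by `m` modulo torsion on a non-empty Zariski open").
Then the route's support item `TorsionDiesGenerically` (Colliot-Thélène–Voisin 2012, Thm. 3.1: a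
torsion class on a non-empty Zariski open dies on a smaller one) yields the crux
`HodgeClassesGenericallyDivisible`: on the smaller open `X ∖ Z'` one has `z| = m • y|`.
[cite: ColliotTheleneVoisin2012, Thm 3.1] -/
theorem hodgeClassesGenericallyDivisible_of_divisibleModTorsion
    (hT : TorsionDiesGenerically)
    (hD : ∀ ⦃p : ℕ⦄ ⦃X : SchemeOver ℂ⦄, 1 ≤ p → IsSmoothProjective (2 * p) X →
      ∀ z : singularCohomology ℤ ℤ (ComplexPoints X) (2 * p),
        IsOfHodgeType (2 * p) X (2 * p) p p
          (singularCohomology.ringChange (Int.castRingHom ℂ) (ComplexPoints X) (2 * p) z) →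
        ∀ m : ℕ, 1 ≤ m → ∃ Z : Set X.left, IsClosed Z ∧ Z ≠ Set.univ ∧
          ∃ (y : singularCohomology ℤ ℤ (complexPointsCompl X Z) (2 * p)) (N : ℕ), 1 ≤ N ∧
            N • (singularCohomology.map ℤ ℤ
                (⟨Subtype.val, continuous_subtype_val⟩ : C(complexPointsCompl X Z, ComplexPoints X))
                (2 * p) z - m • y) = 0) :
    HodgeClassesGenericallyDivisible := by
  unfold Summit.HodgeConjecture.HodgeConjecture.Theses.GenericDivisibility.HodgeClassesGenericallyDivisible
  intro p X hp hX z hz m hm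
  obtain ⟨Z, hZc, hZne, y, N, hN, hNw⟩ := hD hp hX z hz m hm
  -- the torsion class `w = z| - m • y` dies on a smaller non-empty Zariski open `X ∖ Z'`
  obtain ⟨Z', hZZ', hZ'c, hZ'ne, hw⟩ := hT hp hX Z hZc hZne _ N hN hNw
  refine ⟨Z', hZ'c, hZ'ne, singularCohomology.map ℤ ℤ
    (⟨fun P : complexPointsCompl X Z' => (⟨P.1, fun hP : P.1.pt ∈ Z => P.2 (hZZ' hP)⟩ :
        complexPointsCompl X Z),
      continuous_subtype_val.subtype_mk fun (P : complexPointsCompl X Z') (hP : P.1.pt ∈ Z) =>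
        P.2 (hZZ' hP)⟩ : C(complexPointsCompl X Z', complexPointsCompl X Z)) (2 * p) y, ?_⟩
  rw [map_sub, map_nsmul, sub_eq_zero, genericDivisibility_restrict_restrict ℤ hZZ'] at hw
  exact hw.symm

/-- **Generically torsion ⇒ C1.** If every integral middle-degree class with complexification of
Hodge type `(p, p)` on a smooth projective complex `2p`-fold (`p ≥ 1`) is killed by some `N ≥ 1` on
the complex points of some non-empty Zariski open, then `TorsionDiesGenerically`
(Colliot-Thélène–Voisin 2012, Thm. 3.1) gives `HodgeClassesGenericallyDivisible`, with witness
`y = 0` on a smaller open, uniformly in `m`. [cite: ColliotTheleneVoisin2012, Thm 3.1] -/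
theorem hodgeClassesGenericallyDivisible_of_genericallyTorsion
    (hT : TorsionDiesGenerically)
    (hN : ∀ ⦃p : ℕ⦄ ⦃X : SchemeOver ℂ⦄, 1 ≤ p → IsSmoothProjective (2 * p) X →
      ∀ z : singularCohomology ℤ ℤ (ComplexPoints X) (2 * p),
        IsOfHodgeType (2 * p) X (2 * p) p p
          (singularCohomology.ringChange (Int.castRingHom ℂ) (ComplexPoints X) (2 * p) z) →
        ∃ Z : Set X.left, IsClosed Z ∧ Z ≠ Set.univ ∧ ∃ N : ℕ, 1 ≤ N ∧
          N • singularCohomology.map ℤ ℤ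
            (⟨Subtype.val, continuous_subtype_val⟩ : C(complexPointsCompl X Z, ComplexPoints X))
            (2 * p) z = 0) :
    HodgeClassesGenericallyDivisible := by
  refine hodgeClassesGenericallyDivisible_of_divisibleModTorsion hT fun p X hp hX z hz m _ ↦ ?_
  obtain ⟨Z, hZc, hZne, N, hN1, hNz⟩ := hN hp hX z hz
  exact ⟨Z, hZc, hZne, 0, N, hN1, by rwa [smul_zero, sub_zero]⟩

/-! ### Coniveau one of the complexification ⇒ C1 (so the Hodge conjecture implies C1) -/

/-- On an irreducible `ℂ`-scheme, a class of `N¹ Hⁱ(X(ℂ); ℂ) = supportedClasses X i 1` dies on the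
complex points of ONE non-empty Zariski open: a member of the span is a finite sum of classes dying
off closed subsets of codimension `≥ 1`, hence dies off their (closed) union, which misses the
generic point. [cite: GrothendieckTopology1969, §1] -/
theorem genericDivisibility_exists_isClosed_ne_univ_of_mem_supportedClasses_one
    {X : SchemeOver ℂ} [IrreducibleSpace X.left] {i : ℕ} {x : complexBetti X i}
    (hx : x ∈ supportedClasses X i 1) :
    ∃ Z : Set X.left, IsClosed Z ∧ Z ≠ Set.univ ∧ complexBetti.restrictCompl X Z i x = 0 := by
  -- the classes dying off some proper closed subset form a submodule `S`
  let S : Submodule ℂ (complexBetti X i) :=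
    { carrier := {y | ∃ Z : Set X.left, IsClosed Z ∧ Z ≠ Set.univ ∧
        complexBetti.restrictCompl X Z i y = 0}
      add_mem' := by
        rintro a b ⟨Z₁, hZ₁, hZ₁ne, ha⟩ ⟨Z₂, hZ₂, hZ₂ne, hb⟩
        refine ⟨Z₁ ∪ Z₂, hZ₁.union hZ₂, fun h ↦ ?_, ?_⟩
        · rcases isPreirreducible_iff_isClosed_union_isClosed.mp
            (PreirreducibleSpace.isPreirreducible_univ (X := X.left)) Z₁ Z₂ hZ₁ hZ₂ h.symm.subset
            with h₁ | h₂
          · exact hZ₁ne (Set.eq_univ_of_univ_subset h₁)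
          · exact hZ₂ne (Set.eq_univ_of_univ_subset h₂)
        · have ha' := congrArg (singularCohomology.map ℂ ℂ
            (⟨fun P : complexPointsCompl X (Z₁ ∪ Z₂) =>
                (⟨P.1, fun hP : P.1.pt ∈ Z₁ => P.2 (Set.subset_union_left hP)⟩ :
                  complexPointsCompl X Z₁),
              continuous_subtype_val.subtype_mk fun (P : complexPointsCompl X (Z₁ ∪ Z₂))
                (hP : P.1.pt ∈ Z₁) => P.2 (Set.subset_union_left hP)⟩ :
              C(complexPointsCompl X (Z₁ ∪ Z₂), complexPointsCompl X Z₁)) i) ha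
          have hb' := congrArg (singularCohomology.map ℂ ℂ
            (⟨fun P : complexPointsCompl X (Z₁ ∪ Z₂) =>
                (⟨P.1, fun hP : P.1.pt ∈ Z₂ => P.2 (Set.subset_union_right hP)⟩ :
                  complexPointsCompl X Z₂),
              continuous_subtype_val.subtype_mk fun (P : complexPointsCompl X (Z₁ ∪ Z₂))
                (hP : P.1.pt ∈ Z₂) => P.2 (Set.subset_union_right hP)⟩ :
              C(complexPointsCompl X (Z₁ ∪ Z₂), complexPointsCompl X Z₂)) i) hb
          rw [map_zero] at ha' hb'
          change singularCohomology.map ℂ ℂ _ i (singularCohomology.map ℂ ℂ _ i a) = 0 at ha'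
          change singularCohomology.map ℂ ℂ _ i (singularCohomology.map ℂ ℂ _ i b) = 0 at hb'
          rw [genericDivisibility_restrict_restrict ℂ Set.subset_union_left] at ha'
          rw [genericDivisibility_restrict_restrict ℂ Set.subset_union_right] at hb'
          change singularCohomology.map ℂ ℂ _ i (a + b) = 0
          rw [map_add]
          exact (congrArg₂ (· + ·) ha' hb').trans (add_zero 0)
      zero_mem' := ⟨∅, isClosed_empty, fun h ↦ (Set.empty_ne_univ h).elim, map_zero _⟩
      smul_mem' := by
        rintro c a ⟨Z, hZ, hZne, ha⟩
        exact ⟨Z, hZ, hZne, by rw [map_smul, ha, smul_zero]⟩ }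
  suffices h : supportedClasses X i 1 ≤ S from h hx
  refine iSup_le fun Z ↦ iSup_le fun hZ ↦ iSup_le fun hZr z hz ↦ ⟨Z, hZ, fun hZu ↦ ?_, ?_⟩
  · -- a closed subset of codimension `≥ 1` everywhere misses the generic point
    have h0 : Order.coheight (genericPoint X.left) = 0 := by
      rw [Order.coheight_eq_zero]
      intro b _
      exact Scheme.le_iff_specializes.2 ((genericPoint_spec X.left).specializes (Set.mem_univ b))
    have h1 := hZr (genericPoint X.left) (hZu ▸ Set.mem_univ _)
    rw [h0, nonpos_iff_eq_zero, Nat.cast_eq_zero] at h1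
    exact one_ne_zero h1
  · exact LinearMap.mem_ker.1 hz

/-- **Coniveau one of the complexification ⇒ C1, granted universal coefficients on opens and
Colliot-Thélène–Voisin Thm. 3.1.** Hypotheses: (`hUCT`) on a smooth projective complex `2p`-fold, an
integral class on the complex points of a non-empty Zariski open whose complexification vanishes is
killed by some `N ≥ 1` (universal coefficients, `ker (H²ᵖ(U; ℤ) → H²ᵖ(U; ℂ)) = H²ᵖ(U; ℤ)_tors`,
the homology of the smooth quasi-projective `U(ℂ)` being finitely generated — Hatcher Thm. 3.2 with
Cor. A.9; not in the tree for open varieties, hence explicit); (`hT`) the route's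
`TorsionDiesGenerically`; (`hN1`) every integral middle-degree class with `(p, p)` complexification
has complexification in `N¹ H²ᵖ(X(ℂ); ℂ)`. Then `HodgeClassesGenericallyDivisible`: the
complexification dies off one proper closed `Z` (irreducibility of `X`), so `z|` is torsion there by
`hUCT` and dies on a smaller open by `hT`. [cite: HatcherAT2002, §3.1 Thm. 3.2 and Cor. A.9]
[cite: ColliotTheleneVoisin2012, Thm 3.1] [cite: GrothendieckTopology1969, §1] -/
theorem hodgeClassesGenericallyDivisible_of_coniveau_one
    (hUCT : ∀ ⦃p : ℕ⦄ ⦃X : SchemeOver ℂ⦄, 1 ≤ p → IsSmoothProjective (2 * p) X →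
      ∀ (Z : Set X.left), IsClosed Z → Z ≠ Set.univ →
        ∀ w : singularCohomology ℤ ℤ (complexPointsCompl X Z) (2 * p),
          singularCohomology.ringChange (Int.castRingHom ℂ) (complexPointsCompl X Z) (2 * p) w = 0 →
            ∃ N : ℕ, 1 ≤ N ∧ N • w = 0)
    (hT : TorsionDiesGenerically)
    (hN1 : ∀ ⦃p : ℕ⦄ ⦃X : SchemeOver ℂ⦄, 1 ≤ p → IsSmoothProjective (2 * p) X →
      ∀ z : singularCohomology ℤ ℤ (ComplexPoints X) (2 * p),
        IsOfHodgeType (2 * p) X (2 * p) p p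
          (singularCohomology.ringChange (Int.castRingHom ℂ) (ComplexPoints X) (2 * p) z) →
        singularCohomology.ringChange (Int.castRingHom ℂ) (ComplexPoints X) (2 * p) z ∈
          supportedClasses X (2 * p) 1) :
    HodgeClassesGenericallyDivisible := by
  refine hodgeClassesGenericallyDivisible_of_genericallyTorsion hT fun p X hp hX z hz ↦ ?_
  haveI := hX.geometricallyIrreducible
  haveI : IrreducibleSpace X.left :=
    AlgebraicGeometry.GeometricallyIrreducible.irreducibleSpace_of_subsingleton X.hom
  obtain ⟨Z, hZc, hZne, h0⟩ :=
    genericDivisibility_exists_isClosed_ne_univ_of_mem_supportedClasses_one (hN1 hp hX z hz)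
  refine ⟨Z, hZc, hZne, hUCT hp hX Z hZc hZne _ ?_⟩
  rw [genericDivisibility_ringChange_map]
  exact h0

/-- **The Hodge conjecture implies C1 ("C1 is target-implied"), granted universal coefficients on
opens and Colliot-Thélène–Voisin Thm. 3.1.** Under `hUCT` and `TorsionDiesGenerically` as in
`hodgeClassesGenericallyDivisible_of_coniveau_one`, `HodgeConjecture` gives
`HodgeClassesGenericallyDivisible`: the complexification of an integral class is rational, so the
Hodge conjecture for the `2p`-fold `X` puts it in `algebraicClasses X p = Nᵖ H²ᵖ ⊆ N¹ H²ᵖ`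
(`p ≥ 1`). This is the formal content of the route's rationale "HC implies C1 on the nose (Bloch–Kato
torsion-freeness of `𝓗²ᵖ(ℤ)`)". [cite: ColliotTheleneVoisin2012, Thm 3.1]
[cite: HatcherAT2002, §3.1 Thm. 3.2 and p. 198] -/
theorem hodgeClassesGenericallyDivisible_of_hodgeConjecture
    (hUCT : ∀ ⦃p : ℕ⦄ ⦃X : SchemeOver ℂ⦄, 1 ≤ p → IsSmoothProjective (2 * p) X →
      ∀ (Z : Set X.left), IsClosed Z → Z ≠ Set.univ →
        ∀ w : singularCohomology ℤ ℤ (complexPointsCompl X Z) (2 * p),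
          singularCohomology.ringChange (Int.castRingHom ℂ) (complexPointsCompl X Z) (2 * p) w = 0 →
            ∃ N : ℕ, 1 ≤ N ∧ N • w = 0)
    (hT : TorsionDiesGenerically) (hHC : _root_.HodgeConjecture) :
    HodgeClassesGenericallyDivisible := by
  refine hodgeClassesGenericallyDivisible_of_coniveau_one hUCT hT fun p X hp hX z hz ↦ ?_
  have hint : IsIntegralClass
      (singularCohomology.ringChange (Int.castRingHom ℂ) (ComplexPoints X) (2 * p) z) :=
    (isIntegralClass_iff_mem_range_ringChange _).2 ⟨z, rfl⟩
  exact supportedClasses_mono X (2 * p) hp ((hHC hX).2 p _ hint.isRationalClass hz)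

end Summit.HodgeConjecture.HodgeConjecture.Theorems

end
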